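import Literature.Barriers.QuantumFields.JostSchroerSteps
import Mathlib.Analysis.SpecialFunctions.JapaneseBracket
import HarnessLib

/-!
# The holomorphic free two-point function on the forward tube

Companion of `JostSchroerSteps.lean` (barrier catalogue D-0021, summit `QuantumFields`), first
file of the proof of the named fact `FreeFieldTwoPointFn` (the two-point Wightman function of the
free hermitian scalar field of mass `m` in the tree's Euclidean sense is `freeTwoPoint d m`). The
Wick rotation behind that fact is carried by one explicit holomorphic function, defined here:

* `freeTwoPointHol d m ζ = ∫ (4π E_m(ξ⃗))⁻¹ exp (2πi (E_m(ξ⃗) ζ⁰ + ξ⃗·ζ⃗)) dξ⃗` (**definition**),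
  the holomorphic two-point function of the free field of mass `m` in the difference variable
  `ζ = z₁ − z₀ ∈ ℂ^{1+d}` (Streater–Wightman §3-3, Thm 3-5, for the free field: the Laplace
  transform `(2π)^{−3} ∫ d³p/(2ω_p) e^{−ip·(x₀ − x₁)}` of the measure `θ(p⁰)δ(p² − m²)` of
  (3-41)/(4-77), continued to `Im ζ ∈ V₊`; written in Mathlib's Fourier units as in
  `freeTwoPoint`, `p⃗ = −2πξ⃗`, `ω_p = 2πE_m(ξ⃗)`), and
  `freeTwoPointWightmanHol d m z = freeTwoPointHol d m (z 1 − z 0)` on two-point configurations;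
* the size of the integrand (`norm_freeTwoPointHolIntegrand`:
  `(4πE)⁻¹ exp (−2π (E Im ζ⁰ + ξ⃗·Im ζ⃗))`) and the key lower bound on the tube
  (`shellEnergy_mul_add_sum_ge`: `E Im ζ⁰ + ξ⃗·Im ζ⃗ ≥ (Im ζ⁰ − ‖Im ζ⃗‖) ‖ξ⃗‖` — exponential decay
  of the integrand as soon as `Im ζ ∈ V₊`), whence integrability on the tube
  (`integrable_freeTwoPointHolIntegrand`);
* its values at Euclidean points (`freeTwoPointWightmanHol_euclideanPoint`): for Euclidean times
  `t₀ < t₁`, `𝔚(ιx) = ∫ (4πE)⁻¹ e^{−2πE(t₁ − t₀)} 𝐞(⟪ξ⃗, x⃗₁ − x⃗₀⟫) dξ⃗`, the Euclidean two-point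
  kernel of the free covariance (`FreeCovarianceTimeSeparatedProofs`: `e^{−ω|τ|}/(2ω)`, `ω = 2πE`).

Holomorphy on the forward tube, the identification of the Euclidean values with the free
covariance and the boundary values (`freeTwoPoint`) are proved in sibling proof files.

## References

* R. F. Streater, A. S. Wightman, *PCT, Spin and Statistics, and All That*, §3-2 (free field,
  pdf p. 102), §3-3 Thm 3-5 (holomorphic Wightman functions as Laplace transforms, pdf
  pp. 100–101). [StreaterWightman2001]
* J. Glimm, A. Jaffe, *Quantum Physics* (2nd ed. 1987), §6.2 (6.2.6)–(6.2.10), Prop. 6.2.5.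
  [GlimmJaffeQP1987]
-/

noncomputable section

open MeasureTheory Complex Real
open scoped InnerProductSpace SchwartzMap FourierTransform

namespace Literature.Barriers.QuantumFields

open Literature.MathematicalPhysics.QuantumLattice

variable (d : ℕ)

/-! ### The integrand and the holomorphic two-point function -/

/-- The complex-bilinear pairing `ξ⃗·ζ⃗ = Σᵢ ξᵢ ζⁱ` of a real spatial momentum with the spatial
components of a complex space-time point (no conjugation). [folklore] -/
def spatialPairC (ξ : EuclideanSpace ℝ (Fin d)) (ζ : Fin (d + 1) → ℂ) : ℂ :=
  ∑ i : Fin d, (ξ i : ℂ) * ζ i.succ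

/-- The integrand of the holomorphic free two-point function:
`(4π E_m(ξ⃗))⁻¹ exp (2πi (E_m(ξ⃗) ζ⁰ + ξ⃗·ζ⃗))`. [cite: StreaterWightman2001, §3-3 Thm 3-5] -/
def freeTwoPointHolIntegrand (m : ℝ) (ζ : Fin (d + 1) → ℂ) (ξ : EuclideanSpace ℝ (Fin d)) : ℂ :=
  ((4 * π * shellEnergy d m ξ)⁻¹ : ℝ) •
    cexp (2 * π * I * ((shellEnergy d m ξ : ℂ) * ζ 0 + spatialPairC d ξ ζ))

/-- **The holomorphic free two-point function** in the difference variable `ζ = z₁ − z₀`: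
`freeTwoPointHol d m ζ = ∫ (4π E_m(ξ⃗))⁻¹ exp (2πi (E_m(ξ⃗) ζ⁰ + ξ⃗·ζ⃗)) dξ⃗`, the Laplace
transform of the positive-energy mass-shell measure of the free field
(Streater–Wightman Thm 3-5 for the two-point function (3-41) of the free field; Fourier units as in
`freeTwoPoint`). It converges absolutely for `Im ζ ∈ V₊` (`integrable_freeTwoPointHolIntegrand`);
elsewhere it is the junk value of the Bochner integral.
[cite: StreaterWightman2001, §3-3 Thm 3-5] -/
def freeTwoPointHol (m : ℝ) (ζ : Fin (d + 1) → ℂ) : ℂ :=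
  ∫ ξ : EuclideanSpace ℝ (Fin d), freeTwoPointHolIntegrand d m ζ ξ

/-- The holomorphic free two-point function as a function of two complex space-time points,
`𝔚(z₀, z₁) = freeTwoPointHol d m (z₁ − z₀)` (a function of the difference, as in
Streater–Wightman Thm 3-5; the tree's forward tube `forwardTube d 2` requires
`Im (z₁ − z₀) ∈ V₊`). [cite: StreaterWightman2001, §3-3 Thm 3-5] -/
def freeTwoPointWightmanHol (m : ℝ) (z : Fin 2 → Fin (d + 1) → ℂ) : ℂ :=
  freeTwoPointHol d m (z 1 - z 0)

variable {d}

/-- Unfolding lemma for `freeTwoPointWightmanHol`. [folklore] -/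
theorem freeTwoPointWightmanHol_apply (m : ℝ) (z : Fin 2 → Fin (d + 1) → ℂ) :
    freeTwoPointWightmanHol d m z = freeTwoPointHol d m (z 1 - z 0) := rfl

/-- `spatialPairC` is additive in the complex point. [folklore] -/
theorem spatialPairC_add (ξ : EuclideanSpace ℝ (Fin d)) (ζ ζ' : Fin (d + 1) → ℂ) :
    spatialPairC d ξ (ζ + ζ') = spatialPairC d ξ ζ + spatialPairC d ξ ζ' := by
  simp only [spatialPairC, Pi.add_apply, mul_add, Finset.sum_add_distrib]

/-- `spatialPairC` is homogeneous in the complex point. [folklore] -/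
theorem spatialPairC_smul (ξ : EuclideanSpace ℝ (Fin d)) (c : ℂ) (ζ : Fin (d + 1) → ℂ) :
    spatialPairC d ξ (c • ζ) = c * spatialPairC d ξ ζ := by
  simp only [spatialPairC, Pi.smul_apply, smul_eq_mul, Finset.mul_sum]
  exact Finset.sum_congr rfl fun i _ => by ring

/-- The imaginary part of `ξ⃗·ζ⃗` is `ξ⃗·Im ζ⃗`. [folklore] -/
theorem spatialPairC_im (ξ : EuclideanSpace ℝ (Fin d)) (ζ : Fin (d + 1) → ℂ) :
    (spatialPairC d ξ ζ).im = ∑ i : Fin d, ξ i * (ζ i.succ).im := by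
  simp only [spatialPairC, Complex.im_sum, Complex.mul_im, Complex.ofReal_re, Complex.ofReal_im,
    zero_mul, add_zero]

/-- At a real point, `ξ⃗·x⃗` is the real inner product of the spatial parts. [folklore] -/
theorem spatialPairC_complexifyPoint (ξ : EuclideanSpace ℝ (Fin d)) (x : SpaceTime d) :
    spatialPairC d ξ (complexifyPoint x) = (⟪ξ, spaceC d x⟫_ℝ : ℂ) := by
  simp only [spatialPairC, complexifyPoint_apply, PiLp.inner_apply, spaceC_apply,
    RCLike.inner_apply, conj_trivial, Complex.ofReal_sum, Complex.ofReal_mul]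
  exact Finset.sum_congr rfl fun i _ => by ring

/-! ### Size of the integrand -/

/-- **The modulus of the integrand**: `‖(4πE)⁻¹ exp (2πi (E ζ⁰ + ξ⃗·ζ⃗))‖ =
(4πE)⁻¹ exp (−2π (E Im ζ⁰ + ξ⃗·Im ζ⃗))` (for `m ≠ 0`, so that `E > 0`). [folklore] -/
theorem norm_freeTwoPointHolIntegrand {m : ℝ} (hm : m ≠ 0) (ζ : Fin (d + 1) → ℂ)
    (ξ : EuclideanSpace ℝ (Fin d)) :
    ‖freeTwoPointHolIntegrand d m ζ ξ‖ =
      (4 * π * shellEnergy d m ξ)⁻¹ *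
        rexp (-2 * π * (shellEnergy d m ξ * (ζ 0).im + ∑ i : Fin d, ξ i * (ζ i.succ).im)) := by
  have hE := shellEnergy_pos d hm ξ
  rw [freeTwoPointHolIntegrand, norm_smul, Real.norm_of_nonneg (by positivity), Complex.norm_exp]
  congr 1
  congr 1
  simp only [Complex.mul_re, Complex.add_re, Complex.add_im, Complex.mul_im, Complex.re_ofNat,
    Complex.im_ofNat, Complex.ofReal_re, Complex.ofReal_im, Complex.I_re, Complex.I_im,
    spatialPairC_im, mul_zero, zero_mul, sub_zero, add_zero, mul_one]
  ring

/-- **The lower bound behind the convergence on the tube**: with `y = Im ζ`,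
`E_m(ξ⃗) y⁰ + ξ⃗·y⃗ ≥ (y⁰ − ‖y⃗‖) ‖ξ⃗‖` whenever `y⁰ ≥ 0` (Cauchy–Schwarz and `E_m(ξ⃗) ≥ ‖ξ⃗‖`). On the
forward cone `y⁰ > ‖y⃗‖`, so the integrand decays like `e^{−2π(y⁰ − ‖y⃗‖)‖ξ⃗‖}`.
[cite: StreaterWightman2001, §3-3 Thm 3-5 (proof, via Thm 2-8)] -/
theorem shellEnergy_mul_add_sum_ge (m : ℝ) (ξ : EuclideanSpace ℝ (Fin d)) (ζ : Fin (d + 1) → ℂ)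
    (h0 : 0 ≤ (ζ 0).im) :
    ((ζ 0).im - ‖spaceC d (imPart ζ)‖) * ‖ξ‖ ≤
      shellEnergy d m ξ * (ζ 0).im + ∑ i : Fin d, ξ i * (ζ i.succ).im := by
  have hE : ‖ξ‖ ≤ shellEnergy d m ξ := by
    unfold shellEnergy
    calc ‖ξ‖ = Real.sqrt (‖ξ‖ ^ 2) := (Real.sqrt_sq (norm_nonneg _)).symm
      _ ≤ Real.sqrt (‖ξ‖ ^ 2 + (m / (2 * π)) ^ 2) := Real.sqrt_le_sqrt (by nlinarith)
  have hCS : |∑ i : Fin d, ξ i * (ζ i.succ).im| ≤ ‖ξ‖ * ‖spaceC d (imPart ζ)‖ := by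
    have h := abs_real_inner_le_norm ξ (spaceC d (imPart ζ))
    have hinner : ⟪ξ, spaceC d (imPart ζ)⟫_ℝ = ∑ i : Fin d, ξ i * (ζ i.succ).im := by
      simp only [PiLp.inner_apply, spaceC_apply, imPart_apply, RCLike.inner_apply, conj_trivial]
      exact Finset.sum_congr rfl fun i _ => by ring
    rwa [hinner] at h
  have h1 : -(‖ξ‖ * ‖spaceC d (imPart ζ)‖) ≤ ∑ i : Fin d, ξ i * (ζ i.succ).im :=
    (neg_le_neg hCS).trans (neg_abs_le _)
  nlinarith [norm_nonneg ξ, norm_nonneg (spaceC d (imPart ζ))]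

/-- On the tube `Im ζ ∈ V₊` the integrand is bounded by an exponentially decaying function:
`‖integrand‖ ≤ (4π E_m(0))⁻¹ exp (−2π (Im ζ⁰ − ‖Im ζ⃗‖) ‖ξ⃗‖)`. [folklore] -/
theorem norm_freeTwoPointHolIntegrand_le {m : ℝ} (hm : m ≠ 0) {ζ : Fin (d + 1) → ℂ}
    (h0 : 0 ≤ (ζ 0).im) (ξ : EuclideanSpace ℝ (Fin d)) :
    ‖freeTwoPointHolIntegrand d m ζ ξ‖ ≤
      (4 * π * (|m| / (2 * π)))⁻¹ *
        rexp (-2 * π * (((ζ 0).im - ‖spaceC d (imPart ζ)‖) * ‖ξ‖)) := by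
  rw [norm_freeTwoPointHolIntegrand hm]
  have hE := shellEnergy_pos d hm ξ
  have hm' : 0 < |m| / (2 * π) := by positivity
  have hEm : |m| / (2 * π) ≤ shellEnergy d m ξ := by
    unfold shellEnergy
    calc |m| / (2 * π) = Real.sqrt ((m / (2 * π)) ^ 2) := by
          rw [Real.sqrt_sq_eq_abs, abs_div, abs_of_pos (by positivity : (0 : ℝ) < 2 * π)]
      _ ≤ Real.sqrt (‖ξ‖ ^ 2 + (m / (2 * π)) ^ 2) := Real.sqrt_le_sqrt (by nlinarith)
  refine mul_le_mul ?_ ?_ (by positivity) (by positivity)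
  · exact inv_anti₀ (by positivity) (by nlinarith [Real.pi_pos])
  · exact Real.exp_le_exp.2 (by nlinarith [shellEnergy_mul_add_sum_ge m ξ ζ h0, Real.pi_pos])

/-- `(1 + s)^N e^{−βs}` is bounded for `s ≥ 0`: `(1 + s)^N e^{−βs} ≤ N! e^β / β^N`
(from `xᴺ/N! ≤ eˣ` at `x = β(1 + s)`). [folklore] -/
theorem one_add_pow_mul_exp_neg_le {β : ℝ} (hβ : 0 < β) (N : ℕ) {s : ℝ} (hs : 0 ≤ s) :
    (1 + s) ^ N * rexp (-(β * s)) ≤ N.factorial * rexp β / β ^ N := by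
  have h := Real.pow_div_factorial_le_exp (β * (1 + s)) (by positivity) N
  have hN : (0 : ℝ) < N.factorial := by exact_mod_cast N.factorial_pos
  have hβN : 0 < β ^ N := pow_pos hβ N
  rw [mul_pow, div_le_iff₀ hN] at h
  have hexp : rexp (β * (1 + s)) = rexp β * rexp (β * s) := by rw [← Real.exp_add]; ring_nf
  rw [hexp] at h
  have key : β ^ N * ((1 + s) ^ N * rexp (-(β * s))) ≤ N.factorial * rexp β := by
    calc β ^ N * ((1 + s) ^ N * rexp (-(β * s)))
        = (β ^ N * (1 + s) ^ N) * rexp (-(β * s)) := by ring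
      _ ≤ (rexp β * rexp (β * s) * N.factorial) * rexp (-(β * s)) :=
          mul_le_mul_of_nonneg_right h (Real.exp_pos _).le
      _ = N.factorial * rexp β * (rexp (β * s) * rexp (-(β * s))) := by ring
      _ = N.factorial * rexp β := by rw [← Real.exp_add, add_neg_cancel, Real.exp_zero, mul_one]
  rw [le_div_iff₀ hβN]
  calc (1 + s) ^ N * rexp (-(β * s)) * β ^ N = β ^ N * ((1 + s) ^ N * rexp (-(β * s))) := by ring
    _ ≤ _ := key

/-- **Polynomially weighted exponentials are integrable**: `(1 + ‖ξ⃗‖)^k e^{−β‖ξ⃗‖}` is integrable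
on `ℝ^d` for `β > 0` (comparison with the Japanese bracket `(1 + ‖ξ⃗‖)^{−(d+1)}`,
`integrable_one_add_norm`). [folklore] -/
theorem integrable_one_add_norm_pow_mul_exp_neg {β : ℝ} (hβ : 0 < β) (k : ℕ) :
    Integrable fun ξ : EuclideanSpace ℝ (Fin d) => (1 + ‖ξ‖) ^ k * rexp (-(β * ‖ξ‖)) := by
  set N : ℕ := k + (d + 1) with hN
  set C : ℝ := N.factorial * rexp β / β ^ N with hC
  have hJ : Integrable fun ξ : EuclideanSpace ℝ (Fin d) => (1 + ‖ξ‖) ^ (-((d : ℝ) + 1)) :=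
    integrable_one_add_norm (by rw [finrank_euclideanSpace_fin]; linarith)
  refine (hJ.const_mul C).mono' (by fun_prop : Continuous fun ξ : EuclideanSpace ℝ (Fin d) =>
      (1 + ‖ξ‖) ^ k * rexp (-(β * ‖ξ‖))).aestronglyMeasurable (ae_of_all _ fun ξ => ?_)
  have hs : (0 : ℝ) ≤ ‖ξ‖ := norm_nonneg _
  have h1 : 0 < 1 + ‖ξ‖ := by positivity
  rw [Real.norm_of_nonneg (by positivity)]
  have key := one_add_pow_mul_exp_neg_le hβ N hs
  -- `(1+s)^k e^{-βs} = (1+s)^N e^{-βs} · (1+s)^{-(d+1)}`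
  have hsplit : (1 + ‖ξ‖) ^ k * rexp (-(β * ‖ξ‖)) =
      ((1 + ‖ξ‖) ^ N * rexp (-(β * ‖ξ‖))) * (1 + ‖ξ‖) ^ (-((d : ℝ) + 1)) := by
    rw [hN, pow_add, Real.rpow_neg h1.le, show ((d : ℝ) + 1) = ((d + 1 : ℕ) : ℝ) by push_cast; ring,
      Real.rpow_natCast]
    field_simp
  rw [hsplit]
  exact mul_le_mul_of_nonneg_right key (Real.rpow_nonneg h1.le _)

/-- The mass-shell energy is continuous. [folklore] -/
theorem continuous_shellEnergy (m : ℝ) :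
    Continuous fun ξ : EuclideanSpace ℝ (Fin d) => shellEnergy d m ξ := by
  unfold shellEnergy
  fun_prop

/-- `ξ⃗ ↦ ξ⃗·ζ⃗` is continuous. [folklore] -/
theorem continuous_spatialPairC (ζ : Fin (d + 1) → ℂ) :
    Continuous fun ξ : EuclideanSpace ℝ (Fin d) => spatialPairC d ξ ζ := by
  unfold spatialPairC
  refine continuous_finsetSum _ fun i _ => ?_
  exact (Complex.continuous_ofReal.comp (EuclideanSpace.proj i).continuous).mul continuous_const

/-- The integrand is continuous in the momentum (`m ≠ 0`). [folklore] -/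
theorem continuous_freeTwoPointHolIntegrand {m : ℝ} (hm : m ≠ 0) (ζ : Fin (d + 1) → ℂ) :
    Continuous fun ξ : EuclideanSpace ℝ (Fin d) => freeTwoPointHolIntegrand d m ζ ξ := by
  have hE := continuous_shellEnergy (d := d) m
  have hc : Continuous fun ξ : EuclideanSpace ℝ (Fin d) => (4 * π * shellEnergy d m ξ)⁻¹ :=
    (continuous_const.mul hE).inv₀ fun ξ => (mul_pos (by positivity) (shellEnergy_pos d hm ξ)).ne'
  have hsp := continuous_spatialPairC (d := d) ζ
  have he : Continuous fun ξ : EuclideanSpace ℝ (Fin d) =>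
      cexp (2 * π * I * ((shellEnergy d m ξ : ℂ) * ζ 0 + spatialPairC d ξ ζ)) :=
    Complex.continuous_exp.comp (continuous_const.mul
      (((Complex.continuous_ofReal.comp hE).mul continuous_const).add hsp))
  exact hc.smul he

/-- **Absolute convergence on the tube**: for `m ≠ 0` and `Im ζ ∈ V₊` the integrand of
`freeTwoPointHol d m ζ` is integrable. [cite: StreaterWightman2001, §3-3 Thm 3-5] -/
theorem integrable_freeTwoPointHolIntegrand {m : ℝ} (hm : m ≠ 0) {ζ : Fin (d + 1) → ℂ}
    (hζ : imPart ζ ∈ forwardCone d) :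
    Integrable fun ξ : EuclideanSpace ℝ (Fin d) => freeTwoPointHolIntegrand d m ζ ξ := by
  have h0 : 0 < (ζ 0).im := by
    have := hζ.1
    rwa [imPart_apply] at this
  set δ : ℝ := (ζ 0).im - ‖spaceC d (imPart ζ)‖ with hδ
  have hδ0 : 0 < δ := by
    have h := (mem_forwardCone_iff_norm_lt (imPart ζ)).1 hζ
    rw [imPart_apply] at h
    linarith
  have hcont : Continuous fun ξ : EuclideanSpace ℝ (Fin d) => freeTwoPointHolIntegrand d m ζ ξ :=
    continuous_freeTwoPointHolIntegrand hm ζ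
  have hbound := integrable_one_add_norm_pow_mul_exp_neg (d := d) (β := 2 * π * δ) (by positivity) 0
  refine ((hbound.const_mul (4 * π * (|m| / (2 * π)))⁻¹)).mono' hcont.aestronglyMeasurable
    (ae_of_all _ fun ξ => ?_)
  refine (norm_freeTwoPointHolIntegrand_le hm h0.le ξ).trans (le_of_eq ?_)
  simp only [pow_zero, one_mul]
  congr 1
  congr 1
  rw [hδ]
  ring

/-! ### Euclidean points -/

/-- **The free holomorphic two-point function at a Euclidean point**: for Euclidean times
`x₀⁰ < x₁⁰` (so that the Euclidean point lies in the tube), with `τ = x₁⁰ − x₀⁰`,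
`𝔚(ιx) = ∫ (4π E_m(ξ⃗))⁻¹ e^{−2π E_m(ξ⃗) τ} 𝐞(⟪ξ⃗, x⃗₁ − x⃗₀⟫) dξ⃗`: the Euclidean two-point kernel
`e^{−ωτ}/(2ω)`, `ω = 2πE`, of the free covariance (Glimm–Jaffe Prop. 6.2.5; cf.
`freeCovariance_eq_of_timeSeparated`). [cite: GlimmJaffeQP1987, §6.2 Prop 6.2.5] -/
theorem freeTwoPointWightmanHol_euclideanPoint (m : ℝ)
    (x : Fin 2 → EuclideanSpace ℝ (Fin (d + 1))) :
    freeTwoPointWightmanHol d m (euclideanPoint x) =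
      ∫ ξ : EuclideanSpace ℝ (Fin d), ((4 * π * shellEnergy d m ξ)⁻¹ : ℝ) •
        ((rexp (-(2 * π * shellEnergy d m ξ * (x 1 0 - x 0 0))) : ℂ) *
          (𝐞 (⟪ξ, spaceC d (x 1) - spaceC d (x 0)⟫_ℝ) : ℂ)) := by
  rw [freeTwoPointWightmanHol_apply, freeTwoPointHol]
  congr 1
  funext ξ
  rw [freeTwoPointHolIntegrand]
  congr 1
  rw [Real.fourierChar_apply, Complex.ofReal_exp, ← Complex.exp_add]
  congr 1
  have hsp : spatialPairC d ξ (euclideanPoint x 1 - euclideanPoint x 0) =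
      (⟪ξ, spaceC d (x 1) - spaceC d (x 0)⟫_ℝ : ℂ) := by
    simp only [spatialPairC, Pi.sub_apply, euclideanPoint_apply_succ, PiLp.inner_apply,
      PiLp.sub_apply, spaceC_apply, RCLike.inner_apply, conj_trivial, Complex.ofReal_sum,
      Complex.ofReal_mul, Complex.ofReal_sub]
    exact Finset.sum_congr rfl fun i _ => by ring
  rw [hsp, Pi.sub_apply, euclideanPoint_apply_zero, euclideanPoint_apply_zero]
  push_cast
  ring_nf
  rw [Complex.I_sq]
  ring

end Literature.Barriers.QuantumFields
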